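import Mathlib
import Literature.Analysis.Convex.CellinaSelection
import Literature.Analysis.Convex.SchauderFixedPoint
import HarnessLib

/-!
# Cellina's approximate selection theorem and the Kakutani–Fan fixed point theorem — proofs

Discharges of the two named facts of `Literature/Analysis/Convex/CellinaSelection.lean`:

* `BorweinLewis2000_cellina_holds` — Borwein–Lewis 2000, Thm. 8.2.5 (Cellina), by the printed
  proof (§8.2, p. 191): upper hemicontinuity gives radii `δ_x ≤ ε/2` with
  `Ω(z) ⊆ Ω(x) + (ε/2) B` for `z ∈ K ∩ (x + δ_x B)`; a finite subcover of the compact `K` by the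
  balls `x_i + (δ_i/2) B` and the partition of unity `p_i ∝ max(0, δ_i/2 - ‖z - x_i‖)` give the
  continuous `f = Σ p_i y_i` (`y_i ∈ Ω(x_i)`); at `x ∈ K`, with `j` an active index of largest
  radius, every active `y_i` lies in the convex set `Ω(x_j) + (ε/2) B`, hence so does `f(x)`.
* `BorweinLewis2000_kakutaniFan_holds` — Borwein–Lewis 2000, Thm. 8.2.2 (Kakutani–Fan), by the
  printed proof: Cellina's theorem and Brouwer's theorem (the tree's
  `Literature.Analysis.Convex.exists_fixedPoint_of_isCompact_convex`) give approximate fixed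
  points; a limit point of them is a fixed point because a cusco is closed (upper hemicontinuity
  with closed values).

## References
* [BorweinLewis2000] J. M. Borwein, A. S. Lewis, *Convex Analysis and Nonlinear Optimization*,
  Springer (2000), §8.2, Thm. 8.2.2 and Thm. 8.2.5.
-/

namespace Literature.Analysis.Convex

open _root_.Metric _root_.Set _root_.Filter _root_.Topology

section CellinaProof

/-- **Cellina's approximate selection theorem — proved** (discharge of `BorweinLewis2000_cellina`;
Borwein–Lewis 2000, Thm. 8.2.5, by the printed partition-of-unity argument).
[cite: BorweinLewis2000, Thm 8.2.5] -/
theorem BorweinLewis2000_cellina_holds : BorweinLewis2000_cellina := by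
  intro E Y _ _ _ _ _ _ K hK Ω hΩ hne hconv ε hε
  classical
  -- Step 1: radii from upper hemicontinuity, `δ x ≤ ε / 2`
  have husc : ∀ x : E, ∃ δ : ℝ, 0 < δ ∧ δ ≤ ε / 2 ∧
      (x ∈ K → ∀ z ∈ K, dist z x < δ → Ω z ⊆ thickening (ε / 2) (Ω x)) := by
    intro x
    by_cases hx : x ∈ K
    · have hopen : IsOpen (thickening (ε / 2) (Ω x)) := isOpen_thickening
      have hsub : Ω x ⊆ thickening (ε / 2) (Ω x) := self_subset_thickening (by positivity) _
      have hev := (upperHemicontinuousOn_iff_forall_isOpen.1 hΩ) x hx _ hopen hsub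
      obtain ⟨δ, hδ, hδU⟩ := Metric.mem_nhdsWithin_iff.1 hev
      refine ⟨min δ (ε / 2), lt_min hδ (by positivity), min_le_right _ _, fun _ z hz hzx => ?_⟩
      exact hδU ⟨mem_ball.2 (hzx.trans_le (min_le_left _ _)), hz⟩
    · exact ⟨ε / 2, by positivity, le_rfl, fun h => absurd h hx⟩
  choose δ hδpos hδle hδΩ using husc
  -- Step 2: a finite subcover of `K` by the balls `ball x (δ x / 2)`, centres in `K`
  obtain ⟨t, htK, hcover⟩ := hK.elim_nhds_subcover (fun x => ball x (δ x / 2))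
    (fun x _ => ball_mem_nhds x (half_pos (hδpos x)))
  have hcov : ∀ z ∈ K, ∃ c ∈ t, dist z c < δ c / 2 := fun z hz => by
    simpa only [mem_iUnion, mem_ball, exists_prop] using hcover hz
  -- selections `y c ∈ Ω c` (for `c ∈ K`)
  have hsel : ∀ x : E, ∃ y : Y, x ∈ K → y ∈ Ω x := by
    intro x
    by_cases hx : x ∈ K
    · obtain ⟨y, hy⟩ := hne x hx
      exact ⟨y, fun _ => hy⟩
    · exact ⟨0, fun h => absurd h hx⟩
  choose y hyΩ using hsel
  -- Step 3: partition-of-unity weights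
  set wt : E → E → ℝ := fun c z => max 0 (δ c / 2 - dist z c) with hwt
  have hwt_nonneg : ∀ c z, 0 ≤ wt c z := fun c z => le_max_left _ _
  have hwt_cont : ∀ c, Continuous (wt c) := fun c =>
    continuous_const.max (continuous_const.sub (continuous_id.dist continuous_const))
  have hwt_pos_iff : ∀ c z, 0 < wt c z ↔ dist z c < δ c / 2 := fun c z => by
    simp only [hwt, lt_max_iff, lt_self_iff_false, false_or, sub_pos]
  have hS_cont : Continuous fun z => ∑ c ∈ t, wt c z :=
    continuous_finsetSum _ fun c _ => hwt_cont c
  have hS_pos : ∀ z ∈ K, 0 < ∑ c ∈ t, wt c z := by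
    intro z hz
    obtain ⟨c₀, hc₀, hzc₀⟩ := hcov z hz
    exact Finset.sum_pos' (fun c _ => hwt_nonneg c z) ⟨c₀, hc₀, (hwt_pos_iff c₀ z).2 hzc₀⟩
  -- rewriting `f z` as a convex combination
  have hcomb : ∀ z : E, (∑ c ∈ t, wt c z)⁻¹ • ∑ c ∈ t, wt c z • y c
      = ∑ c ∈ t, ((∑ c ∈ t, wt c z)⁻¹ * wt c z) • y c := by
    intro z
    rw [Finset.smul_sum]
    exact Finset.sum_congr rfl fun c _ => by rw [smul_smul]
  have hw1 : ∀ z ∈ K, ∑ c ∈ t, (∑ c ∈ t, wt c z)⁻¹ * wt c z = 1 := by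
    intro z hz
    rw [← Finset.mul_sum]
    exact inv_mul_cancel₀ (hS_pos z hz).ne'
  have hw0 : ∀ z ∈ K, ∀ c, 0 ≤ (∑ c ∈ t, wt c z)⁻¹ * wt c z := fun z hz c =>
    mul_nonneg (inv_nonneg.2 (hS_pos z hz).le) (hwt_nonneg c z)
  -- the approximate selection
  refine ⟨fun z => (∑ c ∈ t, wt c z)⁻¹ • ∑ c ∈ t, wt c z • y c, ?_, ?_, ?_⟩
  · -- continuity on `K`
    refine ContinuousOn.smul ?_ ?_
    · exact hS_cont.continuousOn.inv₀ fun z hz => (hS_pos z hz).ne'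
    · exact (continuous_finsetSum _ fun c _ => (hwt_cont c).smul continuous_const).continuousOn
  · -- the approximate selection property (8.2.6)
    intro x hx
    obtain ⟨c₀, hc₀, hxc₀⟩ := hcov x hx
    have hIne : (t.filter fun c => 0 < wt c x).Nonempty :=
      ⟨c₀, Finset.mem_filter.2 ⟨hc₀, (hwt_pos_iff c₀ x).2 hxc₀⟩⟩
    obtain ⟨j, hjI, hjmax⟩ := Finset.exists_max_image (t.filter fun c => 0 < wt c x) δ hIne
    have hjt : j ∈ t := (Finset.mem_filter.1 hjI).1
    have hjK : j ∈ K := htK j hjt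
    have hxj : dist x j < δ j / 2 := (hwt_pos_iff j x).1 (Finset.mem_filter.1 hjI).2
    -- every active `y c` lies in the convex set `(Ω j)_{ε/2}`
    have hTconv : Convex ℝ (thickening (ε / 2) (Ω j)) := (hconv j hjK).thickening _
    have hyT : ∀ c ∈ t.filter (fun c => 0 < wt c x), y c ∈ thickening (ε / 2) (Ω j) := by
      intro c hc
      obtain ⟨hct, hcpos⟩ := Finset.mem_filter.1 hc
      have hxc : dist x c < δ c / 2 := (hwt_pos_iff c x).1 hcpos
      have hcj : dist c j < δ j := by
        have h1 : dist c j ≤ dist c x + dist x j := dist_triangle _ _ _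
        have h2 : dist c x < δ c / 2 := by rwa [dist_comm] at hxc
        have h3 : δ c ≤ δ j := hjmax c hc
        linarith
      exact hδΩ j hjK c (htK c hct) hcj (hyΩ c (htK c hct))
    -- `f x` is a convex combination of the active `y c`
    have hvec : ∑ c ∈ t.filter (fun c => 0 < wt c x), ((∑ c ∈ t, wt c x)⁻¹ * wt c x) • y c
        = ∑ c ∈ t, ((∑ c ∈ t, wt c x)⁻¹ * wt c x) • y c := by
      refine Finset.sum_filter_of_ne fun c _ hc => ?_
      refine lt_of_le_of_ne (hwt_nonneg c x) fun h0 => hc ?_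
      rw [← h0, mul_zero, zero_smul]
    have hscal : ∑ c ∈ t.filter (fun c => 0 < wt c x), (∑ c ∈ t, wt c x)⁻¹ * wt c x = 1 := by
      rw [← hw1 x hx]
      refine Finset.sum_filter_of_ne fun c _ hc => ?_
      refine lt_of_le_of_ne (hwt_nonneg c x) fun h0 => hc ?_
      rw [← h0, mul_zero]
    have hmem : (∑ c ∈ t, wt c x)⁻¹ • ∑ c ∈ t, wt c x • y c ∈ thickening (ε / 2) (Ω j) := by
      rw [hcomb x, ← hvec]
      exact hTconv.sum_mem (fun c _ => hw0 x hx c) hscal hyT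
    obtain ⟨y', hy', hdist⟩ := mem_thickening_iff.1 hmem
    refine ⟨j, hjK, y', hy', ?_⟩
    rw [← dist_eq_norm, ← dist_eq_norm]
    have : δ j ≤ ε / 2 := hδle j
    linarith
  · -- the range lies in the convex hull of the range of `Ω`
    intro x hx
    show (∑ c ∈ t, wt c x)⁻¹ • ∑ c ∈ t, wt c x • y c ∈ convexHull ℝ (⋃ z ∈ K, Ω z)
    rw [hcomb x]
    refine (convex_convexHull ℝ _).sum_mem (fun c _ => hw0 x hx c) (hw1 x hx) fun c hc => ?_
    exact subset_convexHull ℝ _ (Set.mem_biUnion (htK c hc) (hyΩ c (htK c hc)))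

end CellinaProof

section KakutaniFanProof

/-- **Kakutani–Fan fixed point theorem — proved** (discharge of `BorweinLewis2000_kakutaniFan`;
Borwein–Lewis 2000, Thm. 8.2.2, by the printed proof: Cellina's theorem
(`BorweinLewis2000_cellina_holds`), Brouwer's theorem for compact convex sets
(`exists_fixedPoint_of_isCompact_convex`) and closedness of a cusco).
[cite: BorweinLewis2000, Thm 8.2.2] -/
theorem BorweinLewis2000_kakutaniFan_holds : BorweinLewis2000_kakutaniFan := by
  intro E _ _ _ C hCne hC hCconv Ω hΩ hΩval
  classical
  -- approximate fixed points (Cellina + Brouwer)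
  have happrox : ∀ n : ℕ, ∃ x ∈ C, ∃ x' ∈ C, ∃ y' ∈ Ω x',
      ‖x - x'‖ + ‖x - y'‖ < 1 / ((n : ℝ) + 1) := by
    intro n
    obtain ⟨f, hfc, hfapprox, hfrange⟩ := BorweinLewis2000_cellina_holds C hC Ω hΩ
      (fun x hx => (hΩval x hx).1) (fun x hx => (hΩval x hx).2.2.1) (1 / ((n : ℝ) + 1))
      (by positivity)
    have hsub : (⋃ z ∈ C, Ω z) ⊆ C := Set.iUnion₂_subset fun z hz => (hΩval z hz).2.2.2
    have hmaps : MapsTo f C C := fun x hx => convexHull_min hsub hCconv (hfrange x hx)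
    obtain ⟨x, hxC, hfx⟩ := exists_fixedPoint_of_isCompact_convex hC hCconv hCne ⊤
      (fun x _ => Submodule.mem_top) hfc hmaps
    obtain ⟨x', hx', y', hy', hlt⟩ := hfapprox x hxC
    exact ⟨x, hxC, x', hx', y', hy', by rwa [hfx] at hlt⟩
  choose x hxC x' hx'C y' hy' hlt using happrox
  -- a limit point of the approximate fixed points
  obtain ⟨a, haC, φ, hφ, hφlim⟩ := hC.tendsto_subseq hxC
  refine ⟨a, haC, ?_⟩
  have hε : Tendsto (fun n => (1 : ℝ) / ((φ n : ℕ) + 1)) atTop (𝓝 0) :=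
    tendsto_one_div_add_atTop_nhds_zero_nat.comp hφ.tendsto_atTop
  have hx'lim : Tendsto (x' ∘ φ) atTop (𝓝 a) := by
    refine hφlim.congr_dist (squeeze_zero (fun n => dist_nonneg) (fun n => ?_) hε)
    show dist (x (φ n)) (x' (φ n)) ≤ 1 / ((φ n : ℕ) + 1)
    rw [dist_eq_norm]
    linarith [hlt (φ n), norm_nonneg (x (φ n) - y' (φ n))]
  have hy'lim : Tendsto (y' ∘ φ) atTop (𝓝 a) := by
    refine hφlim.congr_dist (squeeze_zero (fun n => dist_nonneg) (fun n => ?_) hε)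
    show dist (x (φ n)) (y' (φ n)) ≤ 1 / ((φ n : ℕ) + 1)
    rw [dist_eq_norm]
    linarith [hlt (φ n), norm_nonneg (x (φ n) - x' (φ n))]
  -- closedness of the cusco
  by_contra haΩ
  obtain ⟨hne_a, hcpt_a, -, -⟩ := hΩval a haC
  have hpos : 0 < infDist a (Ω a) := (hcpt_a.isClosed.notMem_iff_infDist_pos hne_a).1 haΩ
  obtain ⟨r, hr, hr2⟩ : ∃ r : ℝ, 0 < r ∧ r + r ≤ infDist a (Ω a) :=
    ⟨infDist a (Ω a) / 2, by positivity, by linarith⟩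
  have hU : IsOpen (thickening r (Ω a)) := isOpen_thickening
  have hUsub : Ω a ⊆ thickening r (Ω a) := self_subset_thickening hr _
  have hev := (upperHemicontinuousOn_iff_forall_isOpen.1 hΩ) a haC _ hU hUsub
  have hx'within : Tendsto (x' ∘ φ) atTop (𝓝[C] a) :=
    tendsto_nhdsWithin_iff.2 ⟨hx'lim, Eventually.of_forall fun n => hx'C (φ n)⟩
  have h1 : ∀ᶠ n in atTop, Ω (x' (φ n)) ⊆ thickening r (Ω a) := hx'within hev
  have h2 : ∀ᶠ n in atTop, dist (y' (φ n)) a < r := Metric.tendsto_nhds.1 hy'lim r hr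
  obtain ⟨n, hn1, hn2⟩ := (h1.and h2).exists
  obtain ⟨w, hw, hdw⟩ := mem_thickening_iff.1 (hn1 (hy' (φ n)))
  have h3 : infDist a (Ω a) ≤ dist a w := infDist_le_dist_of_mem hw
  have h4 : dist a w ≤ dist a (y' (φ n)) + dist (y' (φ n)) w := dist_triangle _ _ _
  rw [dist_comm a (y' (φ n))] at h4
  linarith

end KakutaniFanProof

end Literature.Analysis.Convex
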